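import Literature.MathematicalPhysics.QuantumFieldTheory.Balaban1983to89.T4BoundaryRate

/-!
# BoundaryRateSliceGeometry — the slice geometry count `SliceCountGrowing` of the boundary-member frame INHABITED by honest nested
geometry, and its two located necessities: the volume entropy `V ≥ L` and the output's SURPLUS decay (cell `pub-balaban`, T⁴
fan-out, `HOME/BINDER-OWNERS.md` row NE5, route P3 «boundary-functional member»; ROUND-2 skeleton `t4/skeletons/NE5-t4-ne5-p3.md` §3
L14, §7 row B1; lineage t4-ne5-p3 gen 17 — the gen-14 design note executed; [folklore] finite sums; imports the Literature leaf
`T4BoundaryRate` (v1.6.2) ONLY and modifies nothing of it)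

HONEST FRAMING (T4-DAG PAGE 1; identical to the parent's).  The cell's T⁴ target is rung (B)+1: existence AND uniqueness of the
ε → 0 limit of Bałaban's unit-scale averaged loop expectations on a FIXED finite torus — strictly beyond ultraviolet stability,
NOT infinite volume, NOT a mass gap, NOT the Clay problem.  HONEST DEPENDENCY (cell line, verbatim): «continuum YM on T⁴ ⇐
BetaPertH ∧ nine spine estimates (0/9 proved); BetaPertH ⇐ (D1) ∧ (D4) ∧ CAP+tail; G-an2-4 gates asym, D1 and NE2/3/4.»  A TOY
GEOMETRY: nothing of Bałaban's domains is modelled or asserted; `T4BoundaryCarrier.NE5B` is NOT PRINTED and NOT proved here.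

WHAT THIS MODULE DOES (cell GAPS G-ne5p3-3 made two-sided in the kernel).  The parent's binder `SliceCountGrowing G κ w Mc V`
(`Σ_{Y ∈ parents X, scale Y = j} w X Y·e^{−κd(Y)} ≤ Mc·V^{scale X − j}·e^{−κd(X)}`) carries the COUNT of the older parents of step `j` inside an
output; every analytic toy of the lineage has `d ≡ 0`, so neither the weights nor `V` were ever exercised.  Here, on NESTED
`L`-ADIC INTERVALS of a one-dimensional tower (index `(n, i, e)` = `e + 1` consecutive blocks of scale `n` from block `i`; tree length
`e`; the step-`j` parents of an output are ALL its scale-`j` sub-intervals — every older piece localized inside the output feeds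
the t-integral of [Balaban1988Convergent] (3.27) p. 271): §3 `iv_sliceCountGrowing` — WITH the output-decay weight
`outDecay κ₁ X Y = e^{−κ₁d(X)}` at a SURPLUS rate `κ₁ > κ` (the weight of the honest tilt bound, `Support/BoundaryRateWeightedTilt`; print:
p. 262 *"better decay properties, with the number κ replaced, for example, by (1 + 4β)κ"*) the slice count HOLDS with `V = L`
(= `L^d`, `d = 1`) and `Mc = (1 + 1/((κ₁ − κ)e))/(1 − e^{−κ})` (the surplus absorbs the output's length; the parents' decay sums
geometrically — [Balaban1987RG1] (0.26) p. 257 is the printed one-run analogue), hence `KernelDamped` BY NAME with ratio `ω·L`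
(`iv_kernelDamped`).  Part 2 `Support/BoundaryRateSliceGeometrySharp` (same namespace) proves the two located NECESSITIES on this
geometry: `V ≥ L` for any `(Mc, V ≥ 0)` (so the frame's smallness is honestly `δ·L^d < θ`), and NO `(Mc, V)` without the surplus
(`κ₁ = κ`) nor with UNIT weights — the form of the parent's END faces `T4BoundaryRateCollar.ne5B_of_collar/_frame/_pathFrame`; the
located reason for the weighted END faces `Support/BoundaryRateWeightedTilt.ne5B_of_pathFrame₂` etc.
Names used — `T4BoundaryRate`: `Generation(.withK)`, `SliceCountGrowing`, `KernelDamped`, `kernelDamped_of_perParent_growing`,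
`exp_neg_mul_mul_pow_le`; Mathlib: `Finset.sum_image`, `sum_product`, `sum_le_sum_of_subset_of_nonneg`, `geom_sum_Ico_le_of_lt_one`,
Cell record: skeleton `t4/skeletons/NE5-t4-ne5-p3.md` §3 L14 / §7 B1; GAPS G-ne5p3-3. -/

namespace Summit.QuantumFields.BalabanUV.T4Continuum.BoundaryRateSliceGeometry

open Finset
open Literature.MathematicalPhysics.QuantumFieldTheory.Balaban1983to89
open T4OutputRate T4BoundaryCarrier T4BoundaryRate

/-! ## §1 The output-decay weight (general carriers) -/

section Weight
variable {C : T4BoundaryCarrier.Carriers}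

/-- THE OUTPUT-DECAY WEIGHT `e^{−κ₁d(X)}` (a function of the OUTPUT only): the weight the honest tilt bound `KT X Y ≤ kT·u X Y` carries —
the new term's own tree decay at the surplus rate. [folklore] -/
noncomputable def outDecay (C : T4BoundaryCarrier.Carriers) (κ₁ : ℝ) : C.Dom → C.Dom → ℝ :=
  fun X _ => Real.exp (-(κ₁ * C.d X))

/-- Unfolding. [folklore] -/
@[simp] theorem outDecay_apply (κ₁ : ℝ) (X Y : C.Dom) : outDecay C κ₁ X Y = Real.exp (-(κ₁ * C.d X)) := rfl

/-- The weight is positive. [folklore] -/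
theorem outDecay_pos (κ₁ : ℝ) (X Y : C.Dom) : 0 < outDecay C κ₁ X Y := Real.exp_pos _
end Weight

/-! ## §2 The nested-interval geometry -/

/-- THE NESTED-INTERVAL CARRIERS [folklore]: indices `(n, i, e)` = the interval of `e + 1` consecutive blocks of scale `n` starting at block
`i` of a one-dimensional tower (older scales finer by the blocking factor); creation step `n`, tree length `e`; one background per
run, identity transport, one admissible pending field.  A TOY. -/
abbrev ivCarriers : T4BoundaryCarrier.Carriers where
  Dom := ℕ × ℕ × ℕ
  scale := fun X => X.1
  d := fun X => (X.2.2 : ℝ)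
  d_nonneg := fun _ => Nat.cast_nonneg _
  BgA := Unit
  BgB := Unit
  gauge := fun _ _ => 0
  gauge_nonneg := fun _ _ => le_rfl
  transport := fun _ => ()
  Fl := Unit
  admFl := Set.univ

variable (L : ℕ)

/-- Number of scale-`j` blocks in the output `X = (n, i, e)`: `(e + 1)·L^{n − j}`. [folklore] -/
def span (X : ℕ × ℕ × ℕ) (j : ℕ) : ℕ := (X.2.2 + 1) * L ^ (X.1 - j)

/-- Position of the output's left end in scale-`j` blocks. [folklore] -/
def base (X : ℕ × ℕ × ℕ) (j : ℕ) : ℕ := X.2.1 * L ^ (X.1 - j)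

/-- Parameters of the scale-`j` sub-intervals of `X`: offset `p` and extra length `e′` with `p + e′ < span`. [folklore] -/
def sliceIdx (X : ℕ × ℕ × ℕ) (j : ℕ) : Finset (ℕ × ℕ) :=
  ((range (span L X j)) ×ˢ (range (span L X j))).filter (fun pe => pe.1 + pe.2 < span L X j)

/-- The sub-interval with parameters `(p, e′)`. [folklore] -/
def embed (X : ℕ × ℕ × ℕ) (j : ℕ) : ℕ × ℕ → ℕ × ℕ × ℕ := fun pe => (j, base L X j + pe.1, pe.2)

/-- The parametrisation is injective. [folklore] -/
theorem embed_injective (X : ℕ × ℕ × ℕ) (j : ℕ) : Function.Injective (embed L X j) := by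
  intro a b h
  simp only [embed, Prod.mk.injEq] at h
  obtain ⟨_, h1, h2⟩ := h
  exact Prod.ext (by omega) h2

/-- The scale-`j` parents of `X`: all scale-`j` sub-intervals. [folklore] -/
def slicePar (X : ℕ × ℕ × ℕ) (j : ℕ) : Finset (ℕ × ℕ × ℕ) := (sliceIdx L X j).image (embed L X j)

/-- All parents of `X`: the sub-intervals of every older scale. [folklore] -/
def ivParents (X : ℕ × ℕ × ℕ) : Finset (ℕ × ℕ × ℕ) := (range X.1).biUnion (slicePar L X)

/-- A scale-`j` parent has scale `j`. [folklore] -/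
theorem scale_of_mem_slicePar {X Y : ℕ × ℕ × ℕ} {j : ℕ} (h : Y ∈ slicePar L X j) : Y.1 = j := by
  obtain ⟨pe, _, rfl⟩ := mem_image.mp h
  rfl

/-- Parents are strictly older. [folklore] -/
theorem scale_lt_of_mem_ivParents {X Y : ℕ × ℕ × ℕ} (h : Y ∈ ivParents L X) : Y.1 < X.1 := by
  obtain ⟨j, hj, hY⟩ := mem_biUnion.mp h
  rw [scale_of_mem_slicePar L hY]
  exact mem_range.mp hj

/-- THE NESTED-INTERVAL GENERATION DATUM (parents as above; no regular inputs; zero kernels — only the parents and the weights enter the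
slice count; §3's `iv_kernelDamped` re-kernels it through `Generation.withK`). [folklore] -/
def ivGeneration : Generation ivCarriers where
  parents := ivParents L
  parents_lt := fun _ _ h => scale_lt_of_mem_ivParents L h
  eparents := fun _ => ∅
  eparents_lt := fun _ _ h => by simp at h
  K := fun _ _ => 0
  K_nonneg := fun _ _ => le_rfl
  KE := fun _ _ => 0
  KE_nonneg := fun _ _ => le_rfl

/-- The scale-`j` slice of the parents IS the set of scale-`j` sub-intervals. [folklore] -/
theorem filter_parents {X : ℕ × ℕ × ℕ} {j : ℕ} (hj : j < X.1) :
    (ivParents L X).filter (fun Y => Y.1 = j) = slicePar L X j := by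
  ext Y
  simp only [mem_filter, ivParents, mem_biUnion, mem_range]
  constructor
  · rintro ⟨⟨j', _, hY⟩, hYj⟩
    have h' := scale_of_mem_slicePar L hY
    rw [hYj] at h'
    rw [h']
    exact hY
  · intro hY
    exact ⟨⟨j, hj, hY⟩, scale_of_mem_slicePar L hY⟩

/-- Sums over the scale-`j` parents are sums over the parameters. [folklore] -/
theorem sum_slicePar (X : ℕ × ℕ × ℕ) (j : ℕ) (f : ℕ × ℕ × ℕ → ℝ) :
    ∑ Y ∈ slicePar L X j, f Y = ∑ pe ∈ sliceIdx L X j, f (embed L X j pe) :=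
  sum_image fun _ _ _ _ h => embed_injective L X j h

/-- UPPER COUNT [folklore]: a nonnegative function of the parent's extra length sums over the scale-`j` parents to at most
`span × Σ_{e′ < span}` — at most `span` positions per extra length. -/
theorem sum_sliceIdx_le (X : ℕ × ℕ × ℕ) (j : ℕ) {g : ℕ → ℝ} (hg : ∀ e, 0 ≤ g e) :
    ∑ pe ∈ sliceIdx L X j, g pe.2 ≤ (span L X j : ℝ) * ∑ e ∈ range (span L X j), g e := by
  calc ∑ pe ∈ sliceIdx L X j, g pe.2 ≤ ∑ pe ∈ (range (span L X j)) ×ˢ (range (span L X j)), g pe.2 :=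
        sum_le_sum_of_subset_of_nonneg (filter_subset _ _) (fun pe _ _ => hg pe.2)
    _ = ∑ _p ∈ range (span L X j), ∑ e ∈ range (span L X j), g e := sum_product _ _ _
    _ = (span L X j : ℝ) * ∑ e ∈ range (span L X j), g e := by
        rw [sum_const, card_range, nsmul_eq_mul]

/-- The single-block parents of step `j` (extra length `0`), one per position. [folklore] -/
def blocks (X : ℕ × ℕ × ℕ) (j : ℕ) : Finset (ℕ × ℕ × ℕ) := (range (span L X j)).image (fun p => (j, base L X j + p, 0))

/-- Single blocks are parents. [folklore] -/
theorem blocks_subset (X : ℕ × ℕ × ℕ) (j : ℕ) : blocks L X j ⊆ slicePar L X j := by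
  intro Y hY
  obtain ⟨p, hp, rfl⟩ := mem_image.mp hY
  have hp' := mem_range.mp hp
  refine mem_image.mpr ⟨(p, 0), ?_, rfl⟩
  refine mem_filter.mpr ⟨mem_product.mpr ⟨hp, mem_range.mpr (by omega)⟩, ?_⟩
  simpa using hp'

/-- LOWER COUNT [folklore]: a nonnegative function sums over the scale-`j` parents to at least its sum over the `span` single blocks. -/
theorem sum_blocks_le (X : ℕ × ℕ × ℕ) (j : ℕ) {f : ℕ × ℕ × ℕ → ℝ} (hf : ∀ Y, 0 ≤ f Y) :
    ∑ p ∈ range (span L X j), f (j, base L X j + p, 0) ≤ ∑ Y ∈ slicePar L X j, f Y := by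
  have hinj : ∀ p ∈ range (span L X j), ∀ q ∈ range (span L X j),
      (j, base L X j + p, 0) = (j, base L X j + q, 0) → p = q := by
    intro p _ q _ h
    simp only [Prod.mk.injEq] at h
    omega
  rw [← sum_image hinj]
  exact sum_le_sum_of_subset_of_nonneg (blocks_subset L X j) (fun Y _ _ => hf Y)

/-- `e^{−κe′}` as a power. [folklore] -/
theorem exp_neg_mul_nat (κ : ℝ) (n : ℕ) : Real.exp (-(κ * n)) = Real.exp (-κ) ^ n := by
  rw [← Real.exp_nat_mul]
  ring_nf

/-- The parents' own decay sums geometrically: `Σ_{e′ < N} e^{−κe′} ≤ 1/(1 − e^{−κ})` for `κ > 0`. [folklore] -/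
theorem sum_exp_neg_le {κ : ℝ} (hκ : 0 < κ) (N : ℕ) :
    ∑ e ∈ range N, Real.exp (-(κ * e)) ≤ 1 / (1 - Real.exp (-κ)) := by
  have hr0 : 0 ≤ Real.exp (-κ) := (Real.exp_pos _).le
  have hr1 : Real.exp (-κ) < 1 := Real.exp_lt_one_iff.mpr (by linarith)
  have h := geom_sum_Ico_le_of_lt_one hr0 hr1 (m := 0) (n := N)
  simp only [pow_zero] at h
  calc ∑ e ∈ range N, Real.exp (-(κ * e)) = ∑ e ∈ Ico 0 N, Real.exp (-κ) ^ e := by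
        rw [range_eq_Ico]
        exact sum_congr rfl fun e _ => exp_neg_mul_nat κ e
    _ ≤ 1 / (1 - Real.exp (-κ)) := h

/-- The SURPLUS absorbs the output's length: `(e + 1)·e^{−ce} ≤ 1 + 1/(c·e)` for `c > 0` (`e` Euler's number in the bound). [folklore] -/
theorem succ_mul_exp_neg_le {c : ℝ} (hc : 0 < c) (e : ℕ) :
    ((e : ℝ) + 1) * Real.exp (-(c * e)) ≤ 1 + 1 / (c * Real.exp 1) := by
  have h1 : Real.exp (-(c * e)) ≤ 1 := Real.exp_le_one_iff.mpr (by
    have : (0 : ℝ) ≤ c * e := mul_nonneg hc.le (Nat.cast_nonneg e)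
    linarith)
  have h2 : (e : ℝ) * Real.exp (-(c * e)) ≤ 1 / (c * Real.exp 1) := by
    rcases Nat.eq_zero_or_pos e with rfl | he
    · simp only [Nat.cast_zero, zero_mul]
      positivity
    · have h := exp_neg_mul_mul_pow_le hc (Nat.cast_pos.mpr he) 1
      simp only [pow_one, Nat.cast_one] at h
      linarith [h]
  nlinarith [h1, h2]

/-! ## §3 The slice count HOLDS with the surplus weight: `V = L`, explicit `Mc` -/

/-- **`SliceCountGrowing` INHABITED BY HONEST NESTED GEOMETRY** [folklore]: with the output-decay weight at a surplus rate `κ₁ > κ > 0`,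
the nested-interval parents satisfy the slice count with volume entropy `V = L` and
`Mc = (1 + 1/((κ₁ − κ)e))/(1 − e^{−κ})`. -/
theorem iv_sliceCountGrowing {κ κ₁ : ℝ} (hκ : 0 < κ) (hκ₁ : κ < κ₁) :
    SliceCountGrowing (ivGeneration L) κ (outDecay ivCarriers κ₁)
      ((1 + 1 / ((κ₁ - κ) * Real.exp 1)) / (1 - Real.exp (-κ))) L := by
  intro X j hj
  have hj' : j < X.1 := mem_range.mp hj
  change ∑ Y ∈ (ivParents L X).filter (fun Y => Y.1 = j),
      Real.exp (-(κ₁ * (X.2.2 : ℝ))) * Real.exp (-(κ * (Y.2.2 : ℝ))) ≤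
      (1 + 1 / ((κ₁ - κ) * Real.exp 1)) / (1 - Real.exp (-κ)) * (L : ℝ) ^ (X.1 - j) * Real.exp (-(κ * (X.2.2 : ℝ)))
  rw [filter_parents L hj', sum_slicePar, ← mul_sum]
  simp only [embed]
  -- abbreviations
  set e := X.2.2 with he
  set N := span L X j with hN
  have hc : 0 < κ₁ - κ := by linarith
  have hA : 0 < Real.exp (-(κ₁ * (e : ℝ))) := Real.exp_pos _
  have hG0 : 0 < 1 - Real.exp (-κ) := by
    have : Real.exp (-κ) < 1 := Real.exp_lt_one_iff.mpr (by linarith)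
    linarith
  have hS : ∑ pe ∈ sliceIdx L X j, Real.exp (-(κ * ((pe.2 : ℕ) : ℝ))) ≤ (N : ℝ) * (1 / (1 - Real.exp (-κ))) := by
    calc ∑ pe ∈ sliceIdx L X j, Real.exp (-(κ * ((pe.2 : ℕ) : ℝ)))
        ≤ (N : ℝ) * ∑ e' ∈ range N, Real.exp (-(κ * (e' : ℝ))) :=
          sum_sliceIdx_le L X j (g := fun e' => Real.exp (-(κ * (e' : ℝ)))) (fun _ => (Real.exp_pos _).le)
      _ ≤ (N : ℝ) * (1 / (1 - Real.exp (-κ))) :=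
          mul_le_mul_of_nonneg_left (sum_exp_neg_le hκ N) (Nat.cast_nonneg N)
  have hNe : (N : ℝ) = ((e : ℝ) + 1) * (L : ℝ) ^ (X.1 - j) := by
    rw [hN, span]
    push_cast
    ring
  have hsurplus : Real.exp (-(κ₁ * (e : ℝ))) * ((e : ℝ) + 1) ≤
      (1 + 1 / ((κ₁ - κ) * Real.exp 1)) * Real.exp (-(κ * (e : ℝ))) := by
    have hsplit : Real.exp (-(κ₁ * (e : ℝ))) = Real.exp (-(κ * (e : ℝ))) * Real.exp (-((κ₁ - κ) * (e : ℝ))) := by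
      rw [← Real.exp_add]
      ring_nf
    rw [hsplit]
    have h := succ_mul_exp_neg_le hc e
    have hB : 0 < Real.exp (-(κ * (e : ℝ))) := Real.exp_pos _
    nlinarith [h, hB]
  have hLpow : 0 ≤ (L : ℝ) ^ (X.1 - j) := pow_nonneg (Nat.cast_nonneg L) _
  calc Real.exp (-(κ₁ * (e : ℝ))) * ∑ pe ∈ sliceIdx L X j, Real.exp (-(κ * ((pe.2 : ℕ) : ℝ)))
      ≤ Real.exp (-(κ₁ * (e : ℝ))) * ((N : ℝ) * (1 / (1 - Real.exp (-κ)))) :=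
        mul_le_mul_of_nonneg_left hS hA.le
    _ = (Real.exp (-(κ₁ * (e : ℝ))) * ((e : ℝ) + 1)) * (L : ℝ) ^ (X.1 - j) * (1 / (1 - Real.exp (-κ))) := by
        rw [hNe]; ring
    _ ≤ ((1 + 1 / ((κ₁ - κ) * Real.exp 1)) * Real.exp (-(κ * (e : ℝ)))) * (L : ℝ) ^ (X.1 - j) *
          (1 / (1 - Real.exp (-κ))) :=
        mul_le_mul_of_nonneg_right (mul_le_mul_of_nonneg_right hsurplus hLpow) (by positivity)
    _ = (1 + 1 / ((κ₁ - κ) * Real.exp 1)) / (1 - Real.exp (-κ)) * (L : ℝ) ^ (X.1 - j) *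
          Real.exp (-(κ * (e : ℝ))) := by
        field_simp

/-- The slice count transfers to any re-kernelled datum with the same parents. [folklore] -/
theorem sliceCountGrowing_withK {C : T4BoundaryCarrier.Carriers} {G : Generation C} {K : C.Dom → C.Dom → ℝ}
    {hK : ∀ X Y, 0 ≤ K X Y} {κ Mc V : ℝ} {w : C.Dom → C.Dom → ℝ} (h : SliceCountGrowing G κ w Mc V) :
    SliceCountGrowing (G.withK K hK) κ w Mc V :=
  fun X j hj => h X j hj

/-- **HENCE `KernelDamped` BY NAME** [folklore]: a kernel damped per parent by `k₀·ω^{scale separation}` times the surplus weight, on the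
nested-interval parents, is `KernelDamped` with damping ratio `ω·L` and constant `k₀·Mc` (`kernelDamped_of_perParent_growing`) — the
volume entropy multiplies the per-parent damping, which is why the frame's smallness reads `δ·L^d < θ`. -/
theorem iv_kernelDamped {κ κ₁ ω k₀ : ℝ} (hκ : 0 < κ) (hκ₁ : κ < κ₁) (hω : 0 ≤ ω) (hk₀ : 0 ≤ k₀) :
    KernelDamped
      ((ivGeneration L).withK (fun X Y => k₀ * ω ^ (X.1 - Y.1) * outDecay ivCarriers κ₁ X Y)
        (fun X Y => mul_nonneg (mul_nonneg hk₀ (pow_nonneg hω _)) (outDecay_pos κ₁ X Y).le))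
      κ (ω * L) (k₀ * ((1 + 1 / ((κ₁ - κ) * Real.exp 1)) / (1 - Real.exp (-κ)))) :=
  kernelDamped_of_perParent_growing hω hk₀ (fun _ _ _ => le_rfl) (sliceCountGrowing_withK (iv_sliceCountGrowing L hκ hκ₁))

end Summit.QuantumFields.BalabanUV.T4Continuum.BoundaryRateSliceGeometry
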